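import Summits.ValiantsHypothesis.ValiantsHypothesis.Theorems.BarrierLeverPartitionMinorsHitByVPBrickCalculus

/-!
# Route BarrierLever — item `PartitionMinorsHitByVP` (stmt-ValiantsHypothesis-19717):
# exact-cover certificates, part 1/2 — what a nonsingular brick-product layout matrix forces

Helper file (`--supports stmt-ValiantsHypothesis-19717`; cell valiant-natproofs, rung V4, 𝒟-side door (c);
prover seat val-np-p1 gen 14). Definition-free. Closes NO item. Part 2 (`…ExactCoverNoGo`) uses these lemmas to show
that the hypothesis of the exact-cover door (`ExactCoverDoor.partitionMinorsHitByVP_of_bricks_lowerSets`, p556909: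
«every lower-set layout admits `≤ (h+h)³` weighted bricks `1 + ε x^Z y^W` with nonsingular layout matrix») is FALSE.

**Results (any weighted brick list `(ε, Z, W)` in the door's exact shape, any polynomial `f`).**
* `coeff_pexpo_mul_wbrick` — rows of `f · (1 + C ε · x^Z · y^W)`:
  `coeff_{x^U y^W'} = coeff_{x^U y^W'} f + [Z ⊆ U][W ⊆ W'] · ε · coeff_{x^{U∖Z} y^{W'∖W}} f`.
* `exists_cover_of_coeff_ne_zero` — if `coeff_{x^U y^W'} ∏_{i∈s} (1 + C ε_i x^{Z_i} y^{W_i}) ≠ 0` then some sub-list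
  `I ⊆ s` has `Z_i ⊆ U`, `W_i ⊆ W'` (`i ∈ I`), `U ⊆ ⋃_{i∈I} Z_i`, and the `W_i`, `i ∈ I`, pairwise disjoint
  (the surviving part of «exact cover» that the counting argument needs).
* `exists_perm_of_det_ne_zero` — a nonsingular matrix has a transversal of nonzero entries.
* STRIPPING OF PURE BRICKS on LOWER-SET layouts (`u`, `w` injective with lower-set ranges): multiplying the witness by a
  pure `x`-brick `1 + C ε x^Z` (`Z ≠ ∅`) or a pure `y`-brick does not change the layout determinant
  (`det_layout_mul_pureX`, `det_layout_mul_pureY`: a unipotent row/column operation, block-triangular by cardinality),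
  and `1 + C ε` rescales it; hence `det ≠ 0` for the full list implies `det ≠ 0` for the sub-list of MIXED bricks
  (`det_layout_mixed_ne_zero`).

WHAT THIS IS NOT: no statement about item 19717 itself; nothing on crux stmt-ValiantsHypothesis-14610 or `VP` versus `VNP`.
-/

set_option linter.dupNamespace false

namespace Summit.ValiantsHypothesis.ValiantsHypothesis.Theorems.BarrierLever.ExactCoverNoGo

open Finset MvPolynomial
open Summit.ValiantsHypothesis.ValiantsHypothesis.Theorems.BarrierLever.BrickCalculus

noncomputable section

variable {h : ℕ}

/-! ## 1. Weighted bricks and covers -/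

/-- The door's weighted brick is `1 + monomial (x^Z y^W) ε`. -/
theorem wbrick_eq (e : ℂ) (Z W : Finset (Fin h)) :
    (1 + C e * (∏ a ∈ Z, X (Fin.castAdd h a)) * (∏ c ∈ W, X (Fin.natAdd h c)) : MvPolynomial (Fin (h + h)) ℂ) =
      1 + monomial (pexpo Z W) e := by
  rw [prod_X_eq_monomial, prod_X_eq_monomial, mul_assoc, monomial_mul, one_mul, C_mul_monomial, mul_one, pexpo]

/-- **Row rule for one weighted brick, for EVERY polynomial `f`.** -/
theorem coeff_pexpo_mul_wbrick (f : MvPolynomial (Fin (h + h)) ℂ) (e : ℂ) (Z W U W' : Finset (Fin h)) :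
    coeff (pexpo U W') (f * (1 + C e * (∏ a ∈ Z, X (Fin.castAdd h a)) * (∏ c ∈ W, X (Fin.natAdd h c)))) =
      coeff (pexpo U W') f + if Z ⊆ U ∧ W ⊆ W' then e * coeff (pexpo (U \ Z) (W' \ W)) f else 0 := by
  classical
  rw [wbrick_eq, mul_add, mul_one, coeff_add, coeff_mul_monomial']
  congr 1
  by_cases hZW : Z ⊆ U ∧ W ⊆ W'
  · rw [if_pos ((pexpo_le_iff Z W U W').mpr hZW), if_pos hZW, pexpo_sub Z W U W' hZW.1 hZW.2, mul_comm]
  · rw [if_neg (fun hle => hZW ((pexpo_le_iff Z W U W').mp hle)), if_neg hZW]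

/-- `pexpo U W = 0` iff both parts are empty. -/
theorem pexpo_eq_zero_iff (U W : Finset (Fin h)) : pexpo U W = 0 ↔ U = ∅ ∧ W = ∅ := by
  constructor
  · intro h0
    refine ⟨Finset.eq_empty_of_forall_notMem (fun a ha => ?_), Finset.eq_empty_of_forall_notMem (fun c hc => ?_)⟩
    · have := congrArg (fun g => g (Fin.castAdd h a)) h0
      simp only [pexpo_apply_castAdd, if_pos ha, Finsupp.coe_zero, Pi.zero_apply] at this
      exact one_ne_zero this
    · have := congrArg (fun g => g (Fin.natAdd h c)) h0
      simp only [pexpo_apply_natAdd, if_pos hc, Finsupp.coe_zero, Pi.zero_apply] at this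
      exact one_ne_zero this
  · rintro ⟨rfl, rfl⟩; simp [pexpo]

/-- **Cover extraction.** If the `x^U y^W'`-coefficient of a product of weighted bricks is nonzero, some sub-list
`I` consists of bricks inside `(U, W')`, whose `x`-parts cover `U` and whose `y`-parts are pairwise disjoint. -/
theorem exists_cover_of_coeff_ne_zero {ι : Type*} [DecidableEq ι] (ε : ι → ℂ) (Z W : ι → Finset (Fin h))
    (s : Finset ι) : ∀ U W' : Finset (Fin h),
    coeff (pexpo U W') (∏ i ∈ s, (1 + C (ε i) * (∏ a ∈ Z i, X (Fin.castAdd h a)) *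
      (∏ c ∈ W i, X (Fin.natAdd h c))) : MvPolynomial (Fin (h + h)) ℂ) ≠ 0 →
    ∃ I ⊆ s, (∀ i ∈ I, Z i ⊆ U ∧ W i ⊆ W') ∧ U ⊆ I.biUnion Z ∧
      ∀ i ∈ I, ∀ i' ∈ I, i ≠ i' → Disjoint (W i) (W i') := by
  classical
  induction s using Finset.induction_on with
  | empty =>
    intro U W' hne
    rw [Finset.prod_empty, coeff_one] at hne
    have h0 : pexpo U W' = 0 := by by_contra h0; exact hne (if_neg (Ne.symm h0))
    obtain ⟨rfl, rfl⟩ := (pexpo_eq_zero_iff U W').mp h0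
    exact ⟨∅, Finset.empty_subset _, by simp, by simp, by simp⟩
  | insert n s hn ih =>
    intro U W' hne
    rw [Finset.prod_insert hn, mul_comm, coeff_pexpo_mul_wbrick] at hne
    by_cases h1 : coeff (pexpo U W') (∏ i ∈ s, (1 + C (ε i) * (∏ a ∈ Z i, X (Fin.castAdd h a)) *
        (∏ c ∈ W i, X (Fin.natAdd h c))) : MvPolynomial (Fin (h + h)) ℂ) ≠ 0
    · obtain ⟨I, hI, h2, h3, h4⟩ := ih U W' h1
      exact ⟨I, hI.trans (Finset.subset_insert _ _), h2, h3, h4⟩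
    · rw [not_ne_iff.mp h1, zero_add] at hne
      by_cases hc : Z n ⊆ U ∧ W n ⊆ W'
      · rw [if_pos hc] at hne
        have h2 : coeff (pexpo (U \ Z n) (W' \ W n)) (∏ i ∈ s, (1 + C (ε i) *
            (∏ a ∈ Z i, X (Fin.castAdd h a)) * (∏ c ∈ W i, X (Fin.natAdd h c))) :
            MvPolynomial (Fin (h + h)) ℂ) ≠ 0 := fun h0 => hne (by rw [h0, mul_zero])
        obtain ⟨I, hI, hZW, hcov, hdis⟩ := ih _ _ h2
        refine ⟨insert n I, Finset.insert_subset_insert _ hI, ?_, ?_, ?_⟩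
        · intro i hi
          rcases Finset.mem_insert.mp hi with rfl | hi'
          · exact hc
          · exact ⟨(hZW i hi').1.trans Finset.sdiff_subset, (hZW i hi').2.trans Finset.sdiff_subset⟩
        · intro a ha
          rw [Finset.biUnion_insert, Finset.mem_union]
          by_cases haZ : a ∈ Z n
          · exact Or.inl haZ
          · exact Or.inr (hcov (Finset.mem_sdiff.mpr ⟨ha, haZ⟩))
        · intro i hi i' hi' hii'
          have key : ∀ j ∈ I, Disjoint (W n) (W j) := fun j hj =>
            Finset.disjoint_left.mpr (fun c hc hc' => (Finset.mem_sdiff.mp ((hZW j hj).2 hc')).2 hc)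
          rcases Finset.mem_insert.mp hi with rfl | hiI <;> rcases Finset.mem_insert.mp hi' with rfl | hi'I
          · exact absurd rfl hii'
          · exact key i' hi'I
          · exact (key i hiI).symm
          · exact hdis i hiI i' hi'I hii'
      · rw [if_neg hc] at hne; exact absurd rfl hne

/-- A nonsingular matrix has a transversal of nonzero entries. -/
theorem exists_perm_of_det_ne_zero {n : Type*} [Fintype n] [DecidableEq n] {R : Type*} [CommRing R]
    (M : Matrix n n R) (hM : M.det ≠ 0) : ∃ σ : Equiv.Perm n, ∀ i, M (σ i) i ≠ 0 := by
  by_contra hno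
  simp only [not_exists, not_forall, ne_eq, not_not] at hno
  apply hM
  rw [Matrix.det_apply]
  refine Finset.sum_eq_zero (fun σ _ => ?_)
  obtain ⟨i, hi⟩ := hno σ
  rw [Finset.prod_eq_zero (f := fun j => M (σ j) j) (Finset.mem_univ i) hi, smul_zero]

/-! ## 2. Stripping pure bricks on lower-set layouts -/

section strip
variable {r : ℕ} (u w : Fin r → Finset (Fin h))

/-- On a lower-set row family, a row `u i ⊇ Z` has a unique predecessor row `u i' = u i ∖ Z`. -/
theorem exists_row_sdiff (hlow : IsLowerSet (Set.range u)) (Z : Finset (Fin h)) (i : Fin r) :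
    ∃ i', u i' = u i \ Z := by
  have : u i \ Z ∈ Set.range u := hlow (show u i \ Z ≤ u i from Finset.sdiff_subset) ⟨i, rfl⟩
  obtain ⟨i', hi'⟩ := this
  exact ⟨i', hi'⟩

/-- **Pure `x`-bricks are harmless on lower rows.** For `Z ≠ ∅`, multiplying ANY `f` by `1 + C ε x^Z` (the brick
with empty `y`-part) does not change the layout determinant on an injective lower-set row family. -/
theorem det_layout_mul_pureX (hu : Function.Injective u) (hlow : IsLowerSet (Set.range u))
    (f : MvPolynomial (Fin (h + h)) ℂ) (e : ℂ) (Z : Finset (Fin h)) (hZ : Z.Nonempty) :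
    (Matrix.of fun i j : Fin r => coeff (pexpo (u i) (w j))
      (f * (1 + C e * (∏ a ∈ Z, X (Fin.castAdd h a)) * (∏ c ∈ (∅ : Finset (Fin h)), X (Fin.natAdd h c))))).det =
    (Matrix.of fun i j : Fin r => coeff (pexpo (u i) (w j)) f).det := by
  classical
  -- the row-operation matrix
  let N : Matrix (Fin r) (Fin r) ℂ := fun i i' => if Z ⊆ u i ∧ u i' = u i \ Z then e else 0
  have hmul : (Matrix.of fun i j : Fin r => coeff (pexpo (u i) (w j))
      (f * (1 + C e * (∏ a ∈ Z, X (Fin.castAdd h a)) * (∏ c ∈ (∅ : Finset (Fin h)), X (Fin.natAdd h c))))) =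
      (1 + N) * Matrix.of fun i j : Fin r => coeff (pexpo (u i) (w j)) f := by
    ext i j
    rw [Matrix.of_apply, coeff_pexpo_mul_wbrick, Matrix.add_mul, Matrix.one_mul, Matrix.add_apply, Matrix.of_apply,
      Matrix.mul_apply]
    congr 1
    simp only [Finset.empty_subset, and_true, Finset.sdiff_empty, Matrix.of_apply, N]
    by_cases hZi : Z ⊆ u i
    · obtain ⟨i₀, hi₀⟩ := exists_row_sdiff u hlow Z i
      rw [if_pos hZi, Finset.sum_eq_single i₀]
      · rw [if_pos ⟨hZi, hi₀⟩, hi₀]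
      · intro i' _ hi'
        rw [if_neg (fun hc => hi' (hu (hc.2.trans hi₀.symm))), zero_mul]
      · intro hi₀'; exact absurd (Finset.mem_univ _) hi₀'
    · rw [if_neg hZi]
      symm
      exact Finset.sum_eq_zero (fun i' _ => by rw [if_neg (fun hc => hZi hc.1), zero_mul])
  rw [hmul, Matrix.det_mul]
  -- `1 + N` is unipotent: block-triangular by (dual) cardinality with identity diagonal blocks
  have hbt : Matrix.BlockTriangular (1 + N) (fun i => OrderDual.toDual (u i).card) := by
    intro i i' hlt
    have hlt' : (u i).card < (u i').card := hlt
    rw [Matrix.add_apply, Matrix.one_apply, if_neg (fun hii' => by rw [hii'] at hlt'; exact lt_irrefl _ hlt')]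
    simp only [N, zero_add]
    rw [if_neg]
    rintro ⟨hZi, hi'⟩
    have : (u i').card < (u i).card := by
      rw [hi', Finset.card_sdiff_of_subset hZi]
      have := Finset.card_pos.mpr hZ
      have := Finset.card_le_card hZi
      omega
    omega
  rw [hbt.det, Finset.prod_eq_one, one_mul]
  intro a _
  have hblock : (1 + N).toSquareBlock (fun i => OrderDual.toDual (u i).card) a = 1 := by
    ext ⟨i, hi⟩ ⟨i', hi'⟩
    have hcard : (u i).card = (u i').card := by
      have h1 : OrderDual.toDual (u i).card = a := hi
      have h2 : OrderDual.toDual (u i').card = a := hi'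
      exact OrderDual.toDual.injective (h1.trans h2.symm)
    have hN : N i i' = 0 := by
      simp only [N]
      rw [if_neg]
      rintro ⟨hZi, hi'eq⟩
      rw [hi'eq, Finset.card_sdiff_of_subset hZi] at hcard
      have := Finset.card_pos.mpr hZ; have := Finset.card_le_card hZi; omega
    rw [Matrix.toSquareBlock_def, Matrix.of_apply, Matrix.add_apply, Matrix.one_apply, Matrix.one_apply, hN, add_zero]
    by_cases hii' : i = i'
    · subst hii'; rw [if_pos rfl, if_pos rfl]
    · rw [if_neg hii', if_neg (fun hc => hii' (congrArg Subtype.val hc))]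
  rw [hblock, Matrix.det_one]

/-- **Pure `y`-bricks are harmless on lower columns.** For `W ≠ ∅`, multiplying ANY `f` by `1 + C ε y^W` does not
change the layout determinant on an injective lower-set column family. -/
theorem det_layout_mul_pureY (hw : Function.Injective w) (hlow : IsLowerSet (Set.range w))
    (f : MvPolynomial (Fin (h + h)) ℂ) (e : ℂ) (W : Finset (Fin h)) (hW : W.Nonempty) :
    (Matrix.of fun i j : Fin r => coeff (pexpo (u i) (w j))
      (f * (1 + C e * (∏ a ∈ (∅ : Finset (Fin h)), X (Fin.castAdd h a)) * (∏ c ∈ W, X (Fin.natAdd h c))))).det =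
    (Matrix.of fun i j : Fin r => coeff (pexpo (u i) (w j)) f).det := by
  classical
  let N : Matrix (Fin r) (Fin r) ℂ := fun j' j => if W ⊆ w j ∧ w j' = w j \ W then e else 0
  have hmul : (Matrix.of fun i j : Fin r => coeff (pexpo (u i) (w j))
      (f * (1 + C e * (∏ a ∈ (∅ : Finset (Fin h)), X (Fin.castAdd h a)) * (∏ c ∈ W, X (Fin.natAdd h c))))) =
      (Matrix.of fun i j : Fin r => coeff (pexpo (u i) (w j)) f) * (1 + N) := by
    ext i j
    rw [Matrix.of_apply, coeff_pexpo_mul_wbrick, Matrix.mul_add, Matrix.mul_one, Matrix.add_apply, Matrix.of_apply,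
      Matrix.mul_apply]
    congr 1
    simp only [Finset.empty_subset, true_and, Finset.sdiff_empty, Matrix.of_apply, N]
    by_cases hWj : W ⊆ w j
    · obtain ⟨j₀, hj₀⟩ := exists_row_sdiff w hlow W j
      rw [if_pos hWj, Finset.sum_eq_single j₀]
      · rw [if_pos ⟨hWj, hj₀⟩, hj₀, mul_comm]
      · intro j' _ hj'
        rw [if_neg (fun hc => hj' (hw (hc.2.trans hj₀.symm))), mul_zero]
      · intro hj₀'; exact absurd (Finset.mem_univ _) hj₀'
    · rw [if_neg hWj]
      symm
      exact Finset.sum_eq_zero (fun j' _ => by rw [if_neg (fun hc => hWj hc.1), mul_zero])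
  rw [hmul, Matrix.det_mul]
  have hbt : Matrix.BlockTriangular (1 + N) (fun j => (w j).card) := by
    intro j' j hlt
    have hlt' : (w j).card < (w j').card := hlt
    rw [Matrix.add_apply, Matrix.one_apply, if_neg (fun hjj => by rw [hjj] at hlt'; exact lt_irrefl _ hlt')]
    simp only [N, zero_add]
    rw [if_neg]
    rintro ⟨hWj, hj'⟩
    have : (w j').card < (w j).card := by
      rw [hj', Finset.card_sdiff_of_subset hWj]
      have := Finset.card_pos.mpr hW
      have := Finset.card_le_card hWj
      omega
    omega
  rw [hbt.det, Finset.prod_eq_one, mul_one]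
  intro a _
  have hblock : (1 + N).toSquareBlock (fun j => (w j).card) a = 1 := by
    ext ⟨j', hj'⟩ ⟨j, hj⟩
    have hcard : (w j').card = (w j).card := by
      have h1 : (w j').card = a := hj'
      have h2 : (w j).card = a := hj
      exact h1.trans h2.symm
    have hN : N j' j = 0 := by
      simp only [N]
      rw [if_neg]
      rintro ⟨hWj, hjeq⟩
      rw [hjeq, Finset.card_sdiff_of_subset hWj] at hcard
      have := Finset.card_pos.mpr hW; have := Finset.card_le_card hWj; omega
    rw [Matrix.toSquareBlock_def, Matrix.of_apply, Matrix.add_apply, Matrix.one_apply, Matrix.one_apply, hN, add_zero]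
    by_cases hjj : j' = j
    · subst hjj; rw [if_pos rfl, if_pos rfl]
    · rw [if_neg hjj, if_neg (fun hc => hjj (congrArg Subtype.val hc))]
  rw [hblock, Matrix.det_one]

/-- The empty brick `1 + C ε` rescales the layout determinant by `(1 + ε)^r`. -/
theorem det_layout_mul_emptyBrick (f : MvPolynomial (Fin (h + h)) ℂ) (e : ℂ) :
    (Matrix.of fun i j : Fin r => coeff (pexpo (u i) (w j))
      (f * (1 + C e * (∏ a ∈ (∅ : Finset (Fin h)), X (Fin.castAdd h a)) *
        (∏ c ∈ (∅ : Finset (Fin h)), X (Fin.natAdd h c))))).det =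
    (1 + e) ^ r * (Matrix.of fun i j : Fin r => coeff (pexpo (u i) (w j)) f).det := by
  have hmat : (Matrix.of fun i j : Fin r => coeff (pexpo (u i) (w j))
      (f * (1 + C e * (∏ a ∈ (∅ : Finset (Fin h)), X (Fin.castAdd h a)) *
        (∏ c ∈ (∅ : Finset (Fin h)), X (Fin.natAdd h c))))) =
      (1 + e) • (Matrix.of fun i j : Fin r => coeff (pexpo (u i) (w j)) f) := by
    ext i j
    simp only [Finset.prod_empty, mul_one, Matrix.of_apply, Matrix.smul_apply, smul_eq_mul]
    rw [show (1 + C e : MvPolynomial (Fin (h + h)) ℂ) = C (1 + e) by rw [C_add, C_1], mul_comm, coeff_C_mul]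
  rw [hmat, Matrix.det_smul, Fintype.card_fin]

/-- **Stripping.** On an injective lower-set layout, if the layout matrix of the FULL weighted brick product is
nonsingular then so is the layout matrix of the sub-product over the MIXED bricks (both parts nonempty):
pure bricks are unipotent row/column operations, empty bricks are scalars. -/
theorem det_layout_mixed_ne_zero {L : ℕ} (hu : Function.Injective u) (hul : IsLowerSet (Set.range u))
    (hw : Function.Injective w) (hwl : IsLowerSet (Set.range w)) (ε : Fin L → ℂ) (Z W : Fin L → Finset (Fin h))
    (hdet : (Matrix.of fun i j : Fin r => coeff (pexpo (u i) (w j))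
      (∏ l : Fin L, (1 + C (ε l) * (∏ a ∈ Z l, X (Fin.castAdd h a)) * (∏ c ∈ W l, X (Fin.natAdd h c))) :
        MvPolynomial (Fin (h + h)) ℂ)).det ≠ 0) :
    (Matrix.of fun i j : Fin r => coeff (pexpo (u i) (w j))
      (∏ l ∈ Finset.univ.filter (fun l => (Z l).Nonempty ∧ (W l).Nonempty),
        (1 + C (ε l) * (∏ a ∈ Z l, X (Fin.castAdd h a)) * (∏ c ∈ W l, X (Fin.natAdd h c))) :
        MvPolynomial (Fin (h + h)) ℂ)).det ≠ 0 := by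
  classical
  -- peeling non-mixed bricks one at a time
  have key : ∀ t : Finset (Fin L), (∀ l ∈ t, ¬ ((Z l).Nonempty ∧ (W l).Nonempty)) →
      ∀ g : MvPolynomial (Fin (h + h)) ℂ,
      (Matrix.of fun i j : Fin r => coeff (pexpo (u i) (w j))
        (g * ∏ l ∈ t, (1 + C (ε l) * (∏ a ∈ Z l, X (Fin.castAdd h a)) * (∏ c ∈ W l, X (Fin.natAdd h c))))).det ≠ 0 →
      (Matrix.of fun i j : Fin r => coeff (pexpo (u i) (w j)) g).det ≠ 0 := by
    intro t
    induction t using Finset.induction_on with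
    | empty => intro _ g hg; rwa [Finset.prod_empty, mul_one] at hg
    | insert l₀ t hl₀ ih =>
      intro ht g hg
      rw [Finset.prod_insert hl₀, ← mul_assoc] at hg
      have h1 := ih (fun l hl => ht l (Finset.mem_insert_of_mem hl)) _ hg
      have hl₀' := ht l₀ (Finset.mem_insert_self _ _)
      by_cases hZ : (Z l₀).Nonempty
      · have hW : W l₀ = ∅ := Finset.not_nonempty_iff_eq_empty.mp (fun hW => hl₀' ⟨hZ, hW⟩)
        rw [hW, det_layout_mul_pureX u w hu hul g (ε l₀) (Z l₀) hZ] at h1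
        exact h1
      · have hZ' : Z l₀ = ∅ := Finset.not_nonempty_iff_eq_empty.mp hZ
        by_cases hW : (W l₀).Nonempty
        · rw [hZ', det_layout_mul_pureY u w hw hwl g (ε l₀) (W l₀) hW] at h1
          exact h1
        · have hW' : W l₀ = ∅ := Finset.not_nonempty_iff_eq_empty.mp hW
          rw [hZ', hW', det_layout_mul_emptyBrick u w g (ε l₀)] at h1
          exact right_ne_zero_of_mul h1
  rw [← Finset.prod_filter_mul_prod_filter_not Finset.univ (fun l => (Z l).Nonempty ∧ (W l).Nonempty)] at hdet
  exact key _ (fun l hl => (Finset.mem_filter.mp hl).2) _ hdet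

end strip

end

end Summit.ValiantsHypothesis.ValiantsHypothesis.Theorems.BarrierLever.ExactCoverNoGo
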